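import Summits.ABC.IUTFork.Conditional.WRowN3Whole
import Summits.ABC.IUTFork.Conditional.InhUniformBandHullFrey1618481116086272
import Summits.ABC.IUTFork.Conditional.InhUniformBandHullFrey31117999167337103924704
import Summits.ABC.IUTFork.Cor312PilotIdelesPrInvariance
import HarnessLib


/-!
# N3 universe of record, K LINE, ONE NAME — the `«∃ ρ qK, QPinned ∧ PilotKummerCompatHull»` (hull-shape) twin of `WRow.n3_whole`,
# with a GENERIC socket from the K-line (chosen-idele) refuted shape to the hull-shape refutation

PROOF-ONLY file (D-0012; 0 definitions, 0 `Prop` facts, no instance, no notation) of the abc-iut cell — branch C certificate seat abc-iut-C-cert-1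
(gen 11), row «C:N3-K-WHOLE-ONE-NAME» deliverable (3) (KEY N3KWHOLE, RULING C-R164 (a)). TAKES NO SIDE on [IUTchIII] Cor. 3.12 (S. Mochizuki,
*Inter-universal Teichmüller theory III*, Cor. 3.12 p. 173–174; Step (xi-f) p. 184) or on any author; «refuted / inhabited AS TYPED» over OUR sharp
containers ≠ «refuted / asserted in print».

§1 `logv_eq_analyticLogv_of_logvAnalytic`: a family of `p_v`-adic logarithms that is analytic at every prime (`Cor312Vol.LogvAnalytic`) IS c312-5's
`Real.analyticLogv` (function extensionality over the finite places; every place has its residue characteristic). [folklore]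
§2 `WRow.not_exists_qPinned_and_hull_of_chosen` — GENERIC SOCKET (any point `P`, any level `l`, any genuine Θ-volume datum `T`): the K-line refuted
reading «¬ PilotKummerCompatHull at `settingPrVolSharp (pilotDataOfK T.D T.K) (analyticLogv)` with the CHOSEN realising ideles and the pinned
q-reading, for every context binder and Kummer datum» (the first conjunct of `WRow.hex_whole_le_40` / `WRow.n3_whole`) IMPLIES the hull-shape refuted
reading «for every analytic `logv`, every realising (Θ, q)-idele pair, every column datum: ¬ ∃ ρ qK, QPinned ∧ PilotKummerCompatHull» (the shape of
the landed `WRow.not_exists_qPinned_and_hull_*` theorems): §1 pins `logv`, abc-iut-C-cert-3's `Thm311.Real.settingPrVolSharp_pilotDataOfK_eq_chosen`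
pins the ideles, the q-pin `QPinned` rewrites `ρ qK` to the setting's own q-regions, and `PilotKummerCompatHull` does not read the lattice situation's
column data. So the KEY's fallback «REF conjunct only where a `WRow.not_exists_qPinned_and_hull_*` is landed, else vacuous» is NOT needed: the hull
twin carries the SAME 37-row table `(λ, L₀, p, L⁺)` as `WRow.n3_whole` with the SAME strength on both sides.
§3 `WRow.n3_whole_hull`: refuted side through §2 from `WRow.n3_whole` (one line, before the row split); inhabited side = `WRow.n3_inh_all_hull`'s
37-way dispatch BY NAME (p551309), byte for byte. Rows with `L₀ = 0` (`λ = 1/301327048`, `283/8251953408`, `343/59392`) keep a VACUOUS refuted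
conjunct (no ∀T refuted theorem in the tree, as in `WRow.n3_whole`).
HONEST SCOPE: OUR sharp containers and Dupuy–Hilado's typed (Ind1)/(Ind2); admissibility / Szpiro-badness / (P6) of `(ratPoint λ, l)` and
NON-EMPTINESS of the datum type are NOT claimed; a packaging / socket theorem discharges nothing and changes no census count; typed ≠ proved;
instantiated ≠ endorsed; no abc claim.
[cite: Mochizuki2012, IUTchI Def. 3.1 (b),(c) pp. 61–62, Ex. 3.2 (iv) p. 71; IUTchIII Def. 1.1 (i) p. 24, Cor. 3.12 Step (xi-d) p. 183, (xi-f) p. 184; IUTchIV Prop. 1.2 (i)(ii) p. 10, Prop. 1.4 (ii) p. 13, Cor. 2.2 (ii) proof (P5) p. 46] [cite: DupuyHilado2025, §3.3, §3.4, §3.9, §4.9, §4.12] [cite: NeukirchANT1999, Ch. II (5.5)] [claim: Mochizuki2012, status: disputed] for every IUT sentence quoted.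
-/

noncomputable section

open Set Function Metric NumberField IsDedekindDomain

namespace Summit.ABC.IUTFork.Conditional

open Thm311 Thm311.Real Cor312 Cor312Vol Cor312Prov Literature.IUT.LogThetaLattice Literature.IUT.LogVolume
  Literature.IUT.HodgeTheaters Literature.IUT.LogVolume.Cor22
open Literature.NumberTheory.NumberFields Literature.NumberTheory.GaloisRepresentations.Ultrametric
open Literature.NumberTheory.DiophantineGeometry Literature.NumberTheory.DiophantineGeometry.GenEll

/-! ## §1. An everywhere-analytic family of logarithms is the analytic one -/

/-- **Uniqueness of the analytic logarithm family.** If `logv : PadicLogs F` is the analytic `p`-adic logarithm at the places over EVERY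
prime (`Cor312Vol.LogvAnalytic`), then `logv = Real.analyticLogv F`: both are pinned on every unit group `𝒪_v^×` by the same formula
(`Cor312Vol.LogvAnalyticAt` at `p = residueChar F v`). [cite: NeukirchANT1999, Ch. II (5.5)] [folklore] -/
theorem logv_eq_analyticLogv_of_logvAnalytic {F : Type} [Field F] [NumberField F] {logv : PadicLogs F} (hlog : LogvAnalytic logv) :
    logv = analyticLogv F := by
  funext v
  refine AddMonoidHom.ext fun u => ?_
  have h1 := hlog ⟨residueChar F v, residueChar_prime F v⟩ v (natCast_residueChar_mem F v) (Additive.toMul u)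
  have h2 := logvAnalytic_analyticLogv (F := F) ⟨residueChar F v, residueChar_prime F v⟩ v (natCast_residueChar_mem F v) (Additive.toMul u)
  simpa using h1.trans h2.symm

/-! ## §2. The generic socket: K-line (chosen-idele) refuted shape ⟹ hull-shape refutation -/

/-- **GENERIC SOCKET.** For ANY genuine Θ-volume datum `T` (any point, any level): if S_H FAILS in the K-line shape — `¬ PilotKummerCompatHull`
at the sharp real `K`-level setting over the ANALYTIC logarithms with the CHOSEN realising ideles and the pinned q-reading, for every context
binder and every Kummer datum `qK` (first conjunct of `WRow.hex_whole_le_40` / `WRow.n3_whole`) — then for EVERY analytic `logv`, EVERY pair of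
realising (Θ, q)-ideles and EVERY column datum there is NO `(ρ, qK)` with `QPinned ∧ PilotKummerCompatHull` (the shape of the landed
`WRow.not_exists_qPinned_and_hull_*` theorems). Proof: `logv = analyticLogv` (§1); the setting at any realising ideles is the setting at the chosen
ones (`settingPrVolSharp_pilotDataOfK_eq_chosen`); under `QPinned` the region `ρ qK` IS the setting's q-region; the hull clause does not read the
columns. [cite: Mochizuki2012, IUTchI Ex. 3.2 (iv) p. 71; IUTchIII Cor. 3.12 Step (xi-f) p. 184] [cite: DupuyHilado2025, §3.4, §3.9, §4.9]
[claim: Mochizuki2012, status: disputed] -/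
theorem WRow.not_exists_qPinned_and_hull_of_chosen {P : NFPoint} {l : ℕ} (T : Cor22.ThetaVolumeDatumAt P l)
    (hK :
    letI := T.instFieldF; letI := T.instNumberFieldF; letI := T.instAlgebraF; letI := T.instFieldK
    letI := T.instNumberFieldK; letI := T.instAlgebraK; letI := T.instFieldFbar; letI := T.instAlgebraFbar
    letI := T.instAlgebraKFbar; letI := T.instIsElliptic
    ∀ (M : Type) [Field M] [NumberField M]
      (archPk : ∀ (j : (thetaIndex (pilotDataOfK T.D T.K)).Label) (vQ : (thetaIndex (pilotDataOfK T.D T.K)).VQ),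
        Set ((logShellsDH (pilotDataOfK T.D T.K) (analyticLogv T.K)).Packet j vQ))
      (archSub : ∀ (j : (thetaIndex (pilotDataOfK T.D T.K)).Label) (v : (thetaIndex (pilotDataOfK T.D T.K)).V),
        Set ((logShellsDH (pilotDataOfK T.D T.K) (analyticLogv T.K)).Packet j ((thetaIndex (pilotDataOfK T.D T.K)).over v)))
      (Ψ : ℤ → ∀ v : (thetaIndex (pilotDataOfK T.D T.K)).V, v ∈ (thetaIndex (pilotDataOfK T.D T.K)).Vbad →
        Set ((logShellsDH (pilotDataOfK T.D T.K) (analyticLogv T.K)).StarPacket v))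
      (act : ℤ → ∀ v : (thetaIndex (pilotDataOfK T.D T.K)).V, v ∈ (thetaIndex (pilotDataOfK T.D T.K)).Vbad →
        (logShellsDH (pilotDataOfK T.D T.K) (analyticLogv T.K)).StarPacket v →
          Module.End ℚ ((logShellsDH (pilotDataOfK T.D T.K) (analyticLogv T.K)).StarPacket v))
      (Mmod : ℤ → ∀ j : (thetaIndex (pilotDataOfK T.D T.K)).LabelStar, Set ((logShellsDH (pilotDataOfK T.D T.K) (analyticLogv T.K)).GlobalPacket j.1))
      (region : ℤ → ∀ j : (thetaIndex (pilotDataOfK T.D T.K)).LabelStar, FinDivisor M → ∀ vQ : (thetaIndex (pilotDataOfK T.D T.K)).VQ,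
        Set ((logShellsDH (pilotDataOfK T.D T.K) (analyticLogv T.K)).Packet j.1 vQ))
      (frobAdm : ℤ → ℤ → ∀ (j : (thetaIndex (pilotDataOfK T.D T.K)).Label) (vQ : (thetaIndex (pilotDataOfK T.D T.K)).VQ),
        Set ((logShellsDH (pilotDataOfK T.D T.K) (analyticLogv T.K)).Packet j vQ) → Prop)
      (frobLogvol : ℤ → ℤ → ∀ (j : (thetaIndex (pilotDataOfK T.D T.K)).Label) (vQ : (thetaIndex (pilotDataOfK T.D T.K)).VQ),
        Set ((logShellsDH (pilotDataOfK T.D T.K) (analyticLogv T.K)).Packet j vQ) → ℝ)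
      (frobΨ : ℤ → ℤ → ∀ v : (thetaIndex (pilotDataOfK T.D T.K)).V, v ∈ (thetaIndex (pilotDataOfK T.D T.K)).Vbad →
        Set ((logShellsDH (pilotDataOfK T.D T.K) (analyticLogv T.K)).StarPacket v))
      (frobMmod : ℤ → ℤ → ∀ j : (thetaIndex (pilotDataOfK T.D T.K)).LabelStar, Set ((logShellsDH (pilotDataOfK T.D T.K) (analyticLogv T.K)).GlobalPacket j.1))
      (unitImage : ℤ → ℤ → ℕ → ∀ (j : (thetaIndex (pilotDataOfK T.D T.K)).Label) (vQ : (thetaIndex (pilotDataOfK T.D T.K)).VQ),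
        Set ((logShellsDH (pilotDataOfK T.D T.K) (analyticLogv T.K)).Packet j vQ))
      (ballImage : ℤ → ℤ → ∀ (j : (thetaIndex (pilotDataOfK T.D T.K)).Label) (vQ : (thetaIndex (pilotDataOfK T.D T.K)).VQ),
        Set ((logShellsDH (pilotDataOfK T.D T.K) (analyticLogv T.K)).Packet j vQ))
      (thetaDiv : ℤ → ℤ → LgpDivisor M (thetaIndex (pilotDataOfK T.D T.K)).lstar)
      (n : ℤ) {HT : Type} {LogLink : HT → HT → Type} {IsFull : ∀ {s t : HT}, LogLink s t → Prop}
      (lat : LGPGaussianLogThetaLattice LogLink IsFull)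
      {Frd : Type} {IsoF : Frd → Frd → Type} {Ob : Frd → Type} {realify : Frd → Frd} {Strip : Type}
      {IsoS : Strip → Strip → Type} {Mv : ∀ v : (thetaIndex (pilotDataOfK T.D T.K)).V, v ∈ (thetaIndex (pilotDataOfK T.D T.K)).Vbad → Type}
      [∀ v h, Monoid (Mv v h)]
      (sig : GlobalLGPFrobenioidSignature (thetaIndex (pilotDataOfK T.D T.K)).lstar (thetaIndex (pilotDataOfK T.D T.K)).V
        (· ∈ (thetaIndex (pilotDataOfK T.D T.K)).Vbad) Frd IsoF Ob realify Strip IsoS Mv)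
      (split : SplittingMonoids Mv) {ObΔ : Type} {N : ∀ v : (thetaIndex (pilotDataOfK T.D T.K)).V, v ∈ (thetaIndex (pilotDataOfK T.D T.K)).Vbad → Type}
      [∀ v h, Monoid (N v h)] (qData : QPilotData ObΔ N)
      (qK : ∀ v : (thetaIndex (pilotDataOfK T.D T.K)).V, v ∈ (thetaIndex (pilotDataOfK T.D T.K)).Vbad →
        Set ((logShellsDH (pilotDataOfK T.D T.K) (analyticLogv T.K)).StarPacket v)),
      ¬ Cor312Vol.PilotKummerCompatHull
          (LatticeSituation.ofShells (logShellsDH (pilotDataOfK T.D T.K) (analyticLogv T.K)) M archPk archSub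
            (summandPiecesPr (pilotDataOfK T.D T.K) (logvAnalytic_analyticLogv (F := T.K))).Adm
            (summandPiecesPr (pilotDataOfK T.D T.K) (logvAnalytic_analyticLogv (F := T.K))).logvol Ψ act Mmod region frobAdm frobLogvol frobΨ
            frobMmod unitImage ballImage thetaDiv)
          (settingPrVolSharp (pilotDataOfK T.D T.K) (logvAnalytic_analyticLogv (F := T.K)) M archPk archSub Ψ act Mmod region n lat sig split qData
            (exists_realising_qIdeles_pilotDataOfK T.D).choose (exists_realising_thetaIdeles_pilotDataOfK T.D).choose
            (exists_realising_qIdeles_pilotDataOfK T.D).choose_spec.1 (exists_realising_qIdeles_pilotDataOfK T.D).choose_spec.2.1)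
          (fun _ => Cor312.Setting.qRegion
            (settingPrVolSharp (pilotDataOfK T.D T.K) (logvAnalytic_analyticLogv (F := T.K)) M archPk archSub Ψ act Mmod region n lat sig split qData
              (exists_realising_qIdeles_pilotDataOfK T.D).choose (exists_realising_thetaIdeles_pilotDataOfK T.D).choose
              (exists_realising_qIdeles_pilotDataOfK T.D).choose_spec.1 (exists_realising_qIdeles_pilotDataOfK T.D).choose_spec.2.1)) qK) :
    letI := T.instFieldF; letI := T.instNumberFieldF; letI := T.instAlgebraF; letI := T.instFieldK
    letI := T.instNumberFieldK; letI := T.instAlgebraK; letI := T.instFieldFbar; letI := T.instAlgebraFbar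
    letI := T.instAlgebraKFbar; letI := T.instIsElliptic
    ∀ {logv : PadicLogs T.K} (hlog : LogvAnalytic logv) (M : Type) [Field M] [NumberField M]
      (archPk : ∀ (j : (thetaIndex (pilotDataOfK T.D T.K)).Label) (vQ : (thetaIndex (pilotDataOfK T.D T.K)).VQ),
        Set ((logShellsDH (pilotDataOfK T.D T.K) logv).Packet j vQ))
      (archSub : ∀ (j : (thetaIndex (pilotDataOfK T.D T.K)).Label) (v : (thetaIndex (pilotDataOfK T.D T.K)).V),
        Set ((logShellsDH (pilotDataOfK T.D T.K) logv).Packet j ((thetaIndex (pilotDataOfK T.D T.K)).over v)))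
      (Ψ : ℤ → ∀ v : (thetaIndex (pilotDataOfK T.D T.K)).V, v ∈ (thetaIndex (pilotDataOfK T.D T.K)).Vbad →
        Set ((logShellsDH (pilotDataOfK T.D T.K) logv).StarPacket v))
      (act : ℤ → ∀ v : (thetaIndex (pilotDataOfK T.D T.K)).V, v ∈ (thetaIndex (pilotDataOfK T.D T.K)).Vbad →
        (logShellsDH (pilotDataOfK T.D T.K) logv).StarPacket v → Module.End ℚ ((logShellsDH (pilotDataOfK T.D T.K) logv).StarPacket v))
      (Mmod : ℤ → ∀ j : (thetaIndex (pilotDataOfK T.D T.K)).LabelStar, Set ((logShellsDH (pilotDataOfK T.D T.K) logv).GlobalPacket j.1))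
      (region : ℤ → ∀ j : (thetaIndex (pilotDataOfK T.D T.K)).LabelStar, FinDivisor M → ∀ vQ : (thetaIndex (pilotDataOfK T.D T.K)).VQ,
        Set ((logShellsDH (pilotDataOfK T.D T.K) logv).Packet j.1 vQ))
      (n : ℤ) {HT : Type} {LogLink : HT → HT → Type} {IsFull : ∀ {s t : HT}, LogLink s t → Prop}
      (lat : LGPGaussianLogThetaLattice LogLink IsFull)
      {Frd : Type} {IsoF : Frd → Frd → Type} {Ob : Frd → Type} {realify : Frd → Frd} {Strip : Type}
      {IsoS : Strip → Strip → Type} {Mv : ∀ v : (thetaIndex (pilotDataOfK T.D T.K)).V, v ∈ (thetaIndex (pilotDataOfK T.D T.K)).Vbad → Type}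
      [∀ v h, Monoid (Mv v h)]
      (sig : GlobalLGPFrobenioidSignature (thetaIndex (pilotDataOfK T.D T.K)).lstar (thetaIndex (pilotDataOfK T.D T.K)).V
        (· ∈ (thetaIndex (pilotDataOfK T.D T.K)).Vbad) Frd IsoF Ob realify Strip IsoS Mv)
      (split : SplittingMonoids Mv) {ObΔ : Type} {N : ∀ v : (thetaIndex (pilotDataOfK T.D T.K)).V, v ∈ (thetaIndex (pilotDataOfK T.D T.K)).Vbad → Type}
      [∀ v h, Monoid (N v h)] (qData : QPilotData ObΔ N)
      (tq : ∀ (pp : Nat.Primes) (x : (thetaIndex (pilotDataOfK T.D T.K)).Fibre (.inr pp)),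
        haveI : Fact (pp : ℕ).Prime := ⟨pp.2⟩; kOf (pilotDataOfK T.D T.K) pp.1 x)
      (t : ∀ (pp : Nat.Primes) (_ : Fin (pilotDataOfK T.D T.K).lstar) (x : (thetaIndex (pilotDataOfK T.D T.K)).Fibre (.inr pp)),
        haveI : Fact (pp : ℕ).Prime := ⟨pp.2⟩; kOf (pilotDataOfK T.D T.K) pp.1 x)
      (htq0 : ∀ pp x, tq pp x ≠ 0)
      (htq1 : ∀ (pp : Nat.Primes) (x : (thetaIndex (pilotDataOfK T.D T.K)).Fibre (.inr pp)),
        haveI : Fact (pp : ℕ).Prime := ⟨pp.2⟩; placeOf (pilotDataOfK T.D T.K) pp.1 x ∉ (pilotDataOfK T.D T.K).S → ‖tq pp x‖ = 1)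
      (col : ℤ → Column (logShellsDH (pilotDataOfK T.D T.K) logv))
      (_ht0 : ∀ pp i x, t pp i x ≠ 0)
      (_ht : ∀ (pp : Nat.Primes) (i : Fin (pilotDataOfK T.D T.K).lstar) (x : (thetaIndex (pilotDataOfK T.D T.K)).Fibre (.inr pp)),
        haveI : Fact (pp : ℕ).Prime := ⟨pp.2⟩
        Real.log ‖t pp i x‖ = -((pilotDataOfK T.D T.K).thetaPilot i (placeOf (pilotDataOfK T.D T.K) pp.1 x)) *
          logNorm T.K (placeOf (pilotDataOfK T.D T.K) pp.1 x) / localDegree T.K (placeOf (pilotDataOfK T.D T.K) pp.1 x))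
      (_htq : ∀ (pp : Nat.Primes) (x : (thetaIndex (pilotDataOfK T.D T.K)).Fibre (.inr pp)),
        haveI : Fact (pp : ℕ).Prime := ⟨pp.2⟩
        Real.log ‖tq pp x‖ = -((pilotDataOfK T.D T.K).qPilot (placeOf (pilotDataOfK T.D T.K) pp.1 x)) *
          logNorm T.K (placeOf (pilotDataOfK T.D T.K) pp.1 x) / localDegree T.K (placeOf (pilotDataOfK T.D T.K) pp.1 x)),
      ¬ ∃ (ρ : (∀ v : (thetaIndex (pilotDataOfK T.D T.K)).V, v ∈ (thetaIndex (pilotDataOfK T.D T.K)).Vbad →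
              Set ((logShellsDH (pilotDataOfK T.D T.K) logv).StarPacket v)) →
            ∀ (j : (thetaIndex (pilotDataOfK T.D T.K)).Label) (vQ : (thetaIndex (pilotDataOfK T.D T.K)).VQ),
              Set ((logShellsDH (pilotDataOfK T.D T.K) logv).Packet j vQ))
          (qK : ∀ v : (thetaIndex (pilotDataOfK T.D T.K)).V, v ∈ (thetaIndex (pilotDataOfK T.D T.K)).Vbad →
            Set ((logShellsDH (pilotDataOfK T.D T.K) logv).StarPacket v)),
          QPinned ({ toSituation := situationPrVol (pilotDataOfK T.D T.K) hlog M archPk archSub Ψ act Mmod region, col := col } :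
              LatticeSituation (thetaIndex (pilotDataOfK T.D T.K)))
            (settingPrVolSharp (pilotDataOfK T.D T.K) hlog M archPk archSub Ψ act Mmod region n lat sig split qData tq t htq0 htq1) ρ qK ∧
          PilotKummerCompatHull ({ toSituation := situationPrVol (pilotDataOfK T.D T.K) hlog M archPk archSub Ψ act Mmod region, col := col } :
              LatticeSituation (thetaIndex (pilotDataOfK T.D T.K)))
            (settingPrVolSharp (pilotDataOfK T.D T.K) hlog M archPk archSub Ψ act Mmod region n lat sig split qData tq t htq0 htq1) ρ qK := by
  letI := T.instFieldF; letI := T.instNumberFieldF; letI := T.instAlgebraF; letI := T.instFieldK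
  letI := T.instNumberFieldK; letI := T.instAlgebraK; letI := T.instFieldFbar; letI := T.instAlgebraFbar
  letI := T.instAlgebraKFbar; letI := T.instIsElliptic
  intro logv hlog M _ _ archPk archSub Ψ act Mmod region n HT LogLink IsFull lat Frd IsoF Ob realify Strip IsoS Mv _ sig split ObΔ N _ qData
    tq t htq0 htq1 col ht0 ht htq
  obtain rfl : logv = analyticLogv T.K := logv_eq_analyticLogv_of_logvAnalytic hlog
  rw [settingPrVolSharp_pilotDataOfK_eq_chosen T.D M archPk archSub Ψ act Mmod region n lat sig split qData t tq ht0 htq0 htq1 ht htq]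
  rintro ⟨ρ, qK, hq, hc⟩
  exact hK M archPk archSub Ψ act Mmod region (fun n m => (col n).frobAdm m) (fun n m => (col n).frobLogvol m) (fun n m => (col n).frobΨ m)
    (fun n m => (col n).frobMmod m) (fun n m => (col n).unitImage m) (fun n m => (col n).ballImage m) (fun _ _ => 0) n lat sig split qData qK
    (fun j vQ => Set.Subset.trans (hq j vQ).subset (hc j vQ))

/-! ## §3. The hull-shape twin of `WRow.n3_whole` -/

set_option maxHeartbeats 800000 in
/-- **«N3 WHOLE UNDER ONE THEOREM NAME», hull shape (K line).** For every row `(λ, L₀, p, L⁺)` of the SAME 37-row list literal as `WRow.n3_whole`,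
every prime `l ≥ 7` and every genuine Θ-volume datum `T` over `(ratPoint λ, l)`: (1) if `l ≤ L₀` and `l ≠ p`: for every analytic `logv`, every
realising (Θ, q)-idele pair and every column datum, `¬ ∃ ρ qK, QPinned ∧ PilotKummerCompatHull` — from `WRow.n3_whole` through the generic socket
`WRow.not_exists_qPinned_and_hull_of_chosen` (so EVERY row keeps the strength of its K-line band; rows with `L₀ = 0` stay vacuous); (2) if `L⁺ ≤ l`:
`∃ ρ qK, QPinned ∧ PilotKummerCompatHull` — `WRow.n3_inh_all_hull`'s conclusion and 37-way dispatch BY NAME, byte for byte. Packaging —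
discharges nothing. [cite: Mochizuki2012, IUTchI Def. 3.1 (b),(c) pp. 61–62, Ex. 3.2 (iv) p. 71; IUTchIII Cor. 3.12 Step (xi-d) p. 183, (xi-f) p. 184; IUTchIV Prop. 1.2 (i)(ii) p. 10, Prop. 1.4 (ii) p. 13, Cor. 2.2 (ii) proof (P5) p. 46]
[cite: DupuyHilado2025, §3.3, §3.4, §4.9, §4.12] [claim: Mochizuki2012, status: disputed] -/
theorem WRow.n3_whole_hull {q : ℚ} {L0 p Lp l : ℕ}
    (hmem : (q, L0, p, Lp) ∈ ([(((1 : ℕ) : ℚ) / (301327048 : ℕ), 0, 0, 11), (((11 * 103 ^ 8 : ℕ) : ℚ) / (5 ^ 11 * 7 ^ 10 * 79 * 389 ^ 2 : ℕ), 7429469, 103, 7429539), (((13 * 19 ^ 6 : ℕ) : ℚ) / (3 ^ 13 * 11 ^ 2 * 31 : ℕ), 1163, 19, 1181), (((13 ^ 10 * 37 ^ 2 : ℕ) : ℚ) / (2 ^ 26 * 5 ^ 12 * 1873 : ℕ), 114083, 13, 114097), (((13 ^ 5 * 19 ^ 3 : ℕ) : ℚ) / (3 ^ 38 * 397 : ℕ),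 8609207, 0, 8609239), (((17 ^ 4 : ℕ) : ℚ) / (3 ^ 9 * 5 ^ 6 * 13 ^ 5 * 23 * 191 : ℕ), 20063, 7, 20075), (((19 * 1307 : ℕ) : ℚ) / (2 ^ 8 * 3 ^ 22 * 5 ^ 4 : ℕ), 59273, 31, 59287), (((2 * 5 ^ 10 * 13 ^ 4 : ℕ) : ℚ) / (11 ^ 8 * 109 ^ 2 * 3677 ^ 3 : ℕ), 1842, 31, 3709), (((2 : ℕ) : ℚ) / (6436343 : ℕ), 149, 23, 167), (((283 : ℕ) : ℚ) / (8251953408 : ℕ), 0, 0, 13), (((29 ^ 4 * 2213 ^ 2 : ℕ) : ℚ) / (2 ^ 9 * 5 ^ 16 * 11 ^ 9 * 79 : ℕ), 28319539, 23, 28319567), (((2 ^ 11 * 3 ^ 4 * 101 ^ 4 * 29221 : ℕ) : ℚ) / (5 ^ 15 * 17 * 53093 ^ 2 : ℕ), 605971343, 13, 1211942741), (((2 ^ 12 * 13 ^ 3 * 223 ^ 3 : ℕ) : ℚ) / (5 ^ 15 * 179 ^ 4 * 2141 : ℕ), 4079, 0, 6137), (((2 ^ 19 * 367 ^ 3 :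 ℕ) : ℚ) / (13 ^ 2 * 251 ^ 6 : ℕ), 3148231, 251, 3148401), (((2 ^ 2 * 11 : ℕ) : ℚ) / (5 ^ 9 * 139 ^ 6 : ℕ), 532261, 139, 532349), (((2 ^ 2 * 3 ^ 4 * 163 ^ 3 * 1006151 : ℕ) : ℚ) / (11 ^ 9 * 29 ^ 4 * 101 ^ 3 : ℕ), 402268520, 43, 804537083), (((2 ^ 46 * 23 : ℕ) : ℚ) / (19 ^ 11 * 59 * 7207 : ℕ), 148538, 0, 148540), (((2 ^ 5 * 67 ^ 8 * 107 * 22381 : ℕ) : ℚ) / (3 ^ 22 * 7 ^ 14 * 43 * 83 : ℕ), 1322640, 0, 1322706), (((2 ^ 6 * 5 ^ 2 * 7 ^ 13 * 13 ^ 2 * 463 : ℕ) : ℚ) / (11 ^ 12 * 389 ^ 2 * 6841 : ℕ), 1234870181, 43, 1234870267), (((2 ^ 7 * 23 ^ 8 : ℕ) : ℚ) / (3 ^ 22 * 13 * 47 ^ 2 * 263 : ℕ), 23433, 19, 46897), (((3 * 5 ^ 6 * 7 ^ 8 * 53 : ℕ) : ℚ) / (2 * 11 ^ 6 * 193 ^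 4 * 20551 : ℕ), 153707341, 167, 307414715), (((3 ^ 22 * 9787 ^ 2 : ℕ) : ℚ) / (2 ^ 37 * 89 ^ 3 * 167 ^ 2 * 1823 : ℕ), 6600901, 29, 6600945), (((3 ^ 3 * 241 ^ 3 : ℕ) : ℚ) / (2 ^ 15 * 17 ^ 2 * 331 * 1061 ^ 4 : ℕ), 69959, 1061, 70879), (((3 ^ 4 * 23 ^ 6 * 1013 ^ 2 : ℕ) : ℚ) / (7 * 131 ^ 7 * 1373 : ℕ), 147583, 131, 147587), (((3 ^ 5 * 5 ^ 15 * 13 ^ 5 : ℕ) : ℚ) / (2 ^ 11 * 73 ^ 7 * 83 ^ 2 * 197 : ℕ), 26003, 73, 26015), (((5 * 67 ^ 3 * 127 ^ 2 * 19219 : ℕ) : ℚ) / (2 * 3 ^ 15 * 7 ^ 2 * 31 ^ 10 : ℕ), 1957753417, 13, 1957753435), (((5 ^ 11 * 31 * 191 : ℕ) : ℚ) / (3 ^ 30 * 13 ^ 4 * 277 : ℕ), 956537, 0, 956545), (((5 ^ 14 * 19 : ℕ) : ℚ) / (11 ^ 7 * 37 ^ 2 * 353 : ℕ), 5853, 7,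 11739), (((5 ^ 2 * 23 ^ 10 * 106531 : ℕ) : ℚ) / (2 ^ 4 * 3 ^ 19 * 17 ^ 8 * 29 : ℕ), 2051851, 23, 2051897), (((5 ^ 4 * 19 ^ 13 * 103 : ℕ) : ℚ) / (3 ^ 19 * 11 ^ 4 * 463 ^ 5 : ℕ), 2822719, 19, 5645475), (((71 ^ 8 * 233 ^ 3 : ℕ) : ℚ) / (3 ^ 38 * 13 ^ 4 * 5233 : ℕ), 8609207, 0, 8609239), (((73 : ℕ) : ℚ) / (5973865915867209 : ℕ), 13, 7, 29), (((7 ^ 11 * 19 : ℕ) : ℚ) / (2 ^ 28 * 3 ^ 12 * 11 ^ 3 * 67 : ℕ), 815, 7, 1663), (((7 ^ 2 * 41 ^ 2 * 311 ^ 3 : ℕ) : ℚ) / (2 * 3 ^ 3 * 5 ^ 23 * 953 : ℕ), 12991207, 11, 12991229), (((7 ^ 3 * 29 ^ 5 * 151 ^ 2 : ℕ) : ℚ) / (3 ^ 27 * 13 ^ 4 : ℕ), 159389, 0, 159395), (((343 : ℕ) : ℚ) / (59392 : ℕ), 0, 0, 5), (((7 ^ 5 * 61 : ℕ) : ℚ)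 / (3 ^ 13 * 5 ^ 8 * 11 ^ 3 * 53 * 73 ^ 2 * 89 ^ 2 * 103 : ℕ), 836, 7, 1687)] : List (ℚ × ℕ × ℕ × ℕ)))
    (hl : l.Prime) (h7 : 7 ≤ l) (T : Cor22.ThetaVolumeDatumAt (ratPoint q) l) :
    (l ≤ L0 → l ≠ p →
    letI := T.instFieldF; letI := T.instNumberFieldF; letI := T.instAlgebraF; letI := T.instFieldK
    letI := T.instNumberFieldK; letI := T.instAlgebraK; letI := T.instFieldFbar; letI := T.instAlgebraFbar
    letI := T.instAlgebraKFbar; letI := T.instIsElliptic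
    ∀ {logv : PadicLogs T.K} (hlog : LogvAnalytic logv) (M : Type) [Field M] [NumberField M]
      (archPk : ∀ (j : (thetaIndex (pilotDataOfK T.D T.K)).Label) (vQ : (thetaIndex (pilotDataOfK T.D T.K)).VQ),
        Set ((logShellsDH (pilotDataOfK T.D T.K) logv).Packet j vQ))
      (archSub : ∀ (j : (thetaIndex (pilotDataOfK T.D T.K)).Label) (v : (thetaIndex (pilotDataOfK T.D T.K)).V),
        Set ((logShellsDH (pilotDataOfK T.D T.K) logv).Packet j ((thetaIndex (pilotDataOfK T.D T.K)).over v)))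
      (Ψ : ℤ → ∀ v : (thetaIndex (pilotDataOfK T.D T.K)).V, v ∈ (thetaIndex (pilotDataOfK T.D T.K)).Vbad →
        Set ((logShellsDH (pilotDataOfK T.D T.K) logv).StarPacket v))
      (act : ℤ → ∀ v : (thetaIndex (pilotDataOfK T.D T.K)).V, v ∈ (thetaIndex (pilotDataOfK T.D T.K)).Vbad →
        (logShellsDH (pilotDataOfK T.D T.K) logv).StarPacket v → Module.End ℚ ((logShellsDH (pilotDataOfK T.D T.K) logv).StarPacket v))
      (Mmod : ℤ → ∀ j : (thetaIndex (pilotDataOfK T.D T.K)).LabelStar, Set ((logShellsDH (pilotDataOfK T.D T.K) logv).GlobalPacket j.1))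
      (region : ℤ → ∀ j : (thetaIndex (pilotDataOfK T.D T.K)).LabelStar, FinDivisor M → ∀ vQ : (thetaIndex (pilotDataOfK T.D T.K)).VQ,
        Set ((logShellsDH (pilotDataOfK T.D T.K) logv).Packet j.1 vQ))
      (n : ℤ) {HT : Type} {LogLink : HT → HT → Type} {IsFull : ∀ {s t : HT}, LogLink s t → Prop}
      (lat : LGPGaussianLogThetaLattice LogLink IsFull)
      {Frd : Type} {IsoF : Frd → Frd → Type} {Ob : Frd → Type} {realify : Frd → Frd} {Strip : Type}
      {IsoS : Strip → Strip → Type} {Mv : ∀ v : (thetaIndex (pilotDataOfK T.D T.K)).V, v ∈ (thetaIndex (pilotDataOfK T.D T.K)).Vbad → Type}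
      [∀ v h, Monoid (Mv v h)]
      (sig : GlobalLGPFrobenioidSignature (thetaIndex (pilotDataOfK T.D T.K)).lstar (thetaIndex (pilotDataOfK T.D T.K)).V
        (· ∈ (thetaIndex (pilotDataOfK T.D T.K)).Vbad) Frd IsoF Ob realify Strip IsoS Mv)
      (split : SplittingMonoids Mv) {ObΔ : Type} {N : ∀ v : (thetaIndex (pilotDataOfK T.D T.K)).V, v ∈ (thetaIndex (pilotDataOfK T.D T.K)).Vbad → Type}
      [∀ v h, Monoid (N v h)] (qData : QPilotData ObΔ N)
      (tq : ∀ (pp : Nat.Primes) (x : (thetaIndex (pilotDataOfK T.D T.K)).Fibre (.inr pp)),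
        haveI : Fact (pp : ℕ).Prime := ⟨pp.2⟩; kOf (pilotDataOfK T.D T.K) pp.1 x)
      (t : ∀ (pp : Nat.Primes) (_ : Fin (pilotDataOfK T.D T.K).lstar) (x : (thetaIndex (pilotDataOfK T.D T.K)).Fibre (.inr pp)),
        haveI : Fact (pp : ℕ).Prime := ⟨pp.2⟩; kOf (pilotDataOfK T.D T.K) pp.1 x)
      (htq0 : ∀ pp x, tq pp x ≠ 0)
      (htq1 : ∀ (pp : Nat.Primes) (x : (thetaIndex (pilotDataOfK T.D T.K)).Fibre (.inr pp)),
        haveI : Fact (pp : ℕ).Prime := ⟨pp.2⟩; placeOf (pilotDataOfK T.D T.K) pp.1 x ∉ (pilotDataOfK T.D T.K).S → ‖tq pp x‖ = 1)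
      (col : ℤ → Column (logShellsDH (pilotDataOfK T.D T.K) logv))
      (_ht0 : ∀ pp i x, t pp i x ≠ 0)
      (_ht : ∀ (pp : Nat.Primes) (i : Fin (pilotDataOfK T.D T.K).lstar) (x : (thetaIndex (pilotDataOfK T.D T.K)).Fibre (.inr pp)),
        haveI : Fact (pp : ℕ).Prime := ⟨pp.2⟩
        Real.log ‖t pp i x‖ = -((pilotDataOfK T.D T.K).thetaPilot i (placeOf (pilotDataOfK T.D T.K) pp.1 x)) *
          logNorm T.K (placeOf (pilotDataOfK T.D T.K) pp.1 x) / localDegree T.K (placeOf (pilotDataOfK T.D T.K) pp.1 x))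
      (_htq : ∀ (pp : Nat.Primes) (x : (thetaIndex (pilotDataOfK T.D T.K)).Fibre (.inr pp)),
        haveI : Fact (pp : ℕ).Prime := ⟨pp.2⟩
        Real.log ‖tq pp x‖ = -((pilotDataOfK T.D T.K).qPilot (placeOf (pilotDataOfK T.D T.K) pp.1 x)) *
          logNorm T.K (placeOf (pilotDataOfK T.D T.K) pp.1 x) / localDegree T.K (placeOf (pilotDataOfK T.D T.K) pp.1 x)),
      ¬ ∃ (ρ : (∀ v : (thetaIndex (pilotDataOfK T.D T.K)).V, v ∈ (thetaIndex (pilotDataOfK T.D T.K)).Vbad →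
              Set ((logShellsDH (pilotDataOfK T.D T.K) logv).StarPacket v)) →
            ∀ (j : (thetaIndex (pilotDataOfK T.D T.K)).Label) (vQ : (thetaIndex (pilotDataOfK T.D T.K)).VQ),
              Set ((logShellsDH (pilotDataOfK T.D T.K) logv).Packet j vQ))
          (qK : ∀ v : (thetaIndex (pilotDataOfK T.D T.K)).V, v ∈ (thetaIndex (pilotDataOfK T.D T.K)).Vbad →
            Set ((logShellsDH (pilotDataOfK T.D T.K) logv).StarPacket v)),
          QPinned ({ toSituation := situationPrVol (pilotDataOfK T.D T.K) hlog M archPk archSub Ψ act Mmod region, col := col } :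
              LatticeSituation (thetaIndex (pilotDataOfK T.D T.K)))
            (settingPrVolSharp (pilotDataOfK T.D T.K) hlog M archPk archSub Ψ act Mmod region n lat sig split qData tq t htq0 htq1) ρ qK ∧
          PilotKummerCompatHull ({ toSituation := situationPrVol (pilotDataOfK T.D T.K) hlog M archPk archSub Ψ act Mmod region, col := col } :
              LatticeSituation (thetaIndex (pilotDataOfK T.D T.K)))
            (settingPrVolSharp (pilotDataOfK T.D T.K) hlog M archPk archSub Ψ act Mmod region n lat sig split qData tq t htq0 htq1) ρ qK) ∧
    (Lp ≤ l →
    letI := T.instFieldF; letI := T.instNumberFieldF; letI := T.instAlgebraF; letI := T.instFieldK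
    letI := T.instNumberFieldK; letI := T.instAlgebraK; letI := T.instFieldFbar; letI := T.instAlgebraFbar
    letI := T.instAlgebraKFbar; letI := T.instIsElliptic
    ∀ {logv : PadicLogs T.K} (hlog : LogvAnalytic logv) (M : Type) [Field M] [NumberField M]
      (archPk : ∀ (j : (thetaIndex (pilotDataOfK T.D T.K)).Label) (vQ : (thetaIndex (pilotDataOfK T.D T.K)).VQ),
        Set ((logShellsDH (pilotDataOfK T.D T.K) logv).Packet j vQ))
      (archSub : ∀ (j : (thetaIndex (pilotDataOfK T.D T.K)).Label) (v : (thetaIndex (pilotDataOfK T.D T.K)).V),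
        Set ((logShellsDH (pilotDataOfK T.D T.K) logv).Packet j ((thetaIndex (pilotDataOfK T.D T.K)).over v)))
      (Ψ : ℤ → ∀ v : (thetaIndex (pilotDataOfK T.D T.K)).V, v ∈ (thetaIndex (pilotDataOfK T.D T.K)).Vbad →
        Set ((logShellsDH (pilotDataOfK T.D T.K) logv).StarPacket v))
      (act : ℤ → ∀ v : (thetaIndex (pilotDataOfK T.D T.K)).V, v ∈ (thetaIndex (pilotDataOfK T.D T.K)).Vbad →
        (logShellsDH (pilotDataOfK T.D T.K) logv).StarPacket v → Module.End ℚ ((logShellsDH (pilotDataOfK T.D T.K) logv).StarPacket v))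
      (Mmod : ℤ → ∀ j : (thetaIndex (pilotDataOfK T.D T.K)).LabelStar, Set ((logShellsDH (pilotDataOfK T.D T.K) logv).GlobalPacket j.1))
      (region : ℤ → ∀ j : (thetaIndex (pilotDataOfK T.D T.K)).LabelStar, FinDivisor M → ∀ vQ : (thetaIndex (pilotDataOfK T.D T.K)).VQ,
        Set ((logShellsDH (pilotDataOfK T.D T.K) logv).Packet j.1 vQ))
      (n : ℤ) {HT : Type} {LogLink : HT → HT → Type} {IsFull : ∀ {s t : HT}, LogLink s t → Prop}
      (lat : LGPGaussianLogThetaLattice LogLink IsFull)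
      {Frd : Type} {IsoF : Frd → Frd → Type} {Ob : Frd → Type} {realify : Frd → Frd} {Strip : Type}
      {IsoS : Strip → Strip → Type} {Mv : ∀ v : (thetaIndex (pilotDataOfK T.D T.K)).V, v ∈ (thetaIndex (pilotDataOfK T.D T.K)).Vbad → Type}
      [∀ v h, Monoid (Mv v h)]
      (sig : GlobalLGPFrobenioidSignature (thetaIndex (pilotDataOfK T.D T.K)).lstar (thetaIndex (pilotDataOfK T.D T.K)).V
        (· ∈ (thetaIndex (pilotDataOfK T.D T.K)).Vbad) Frd IsoF Ob realify Strip IsoS Mv)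
      (split : SplittingMonoids Mv) {ObΔ : Type} {N : ∀ v : (thetaIndex (pilotDataOfK T.D T.K)).V, v ∈ (thetaIndex (pilotDataOfK T.D T.K)).Vbad → Type}
      [∀ v h, Monoid (N v h)] (qData : QPilotData ObΔ N)
      (tq : ∀ (pp : Nat.Primes) (x : (thetaIndex (pilotDataOfK T.D T.K)).Fibre (.inr pp)),
        haveI : Fact (pp : ℕ).Prime := ⟨pp.2⟩; kOf (pilotDataOfK T.D T.K) pp.1 x)
      (t : ∀ (pp : Nat.Primes) (_ : Fin (pilotDataOfK T.D T.K).lstar) (x : (thetaIndex (pilotDataOfK T.D T.K)).Fibre (.inr pp)),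
        haveI : Fact (pp : ℕ).Prime := ⟨pp.2⟩; kOf (pilotDataOfK T.D T.K) pp.1 x)
      (htq0 : ∀ pp x, tq pp x ≠ 0)
      (htq1 : ∀ (pp : Nat.Primes) (x : (thetaIndex (pilotDataOfK T.D T.K)).Fibre (.inr pp)),
        haveI : Fact (pp : ℕ).Prime := ⟨pp.2⟩; placeOf (pilotDataOfK T.D T.K) pp.1 x ∉ (pilotDataOfK T.D T.K).S → ‖tq pp x‖ = 1)
      (col : ℤ → Column (logShellsDH (pilotDataOfK T.D T.K) logv))
      (_ht0 : ∀ pp i x, t pp i x ≠ 0)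
      (_ht : ∀ (pp : Nat.Primes) (i : Fin (pilotDataOfK T.D T.K).lstar) (x : (thetaIndex (pilotDataOfK T.D T.K)).Fibre (.inr pp)),
        haveI : Fact (pp : ℕ).Prime := ⟨pp.2⟩
        Real.log ‖t pp i x‖ = -((pilotDataOfK T.D T.K).thetaPilot i (placeOf (pilotDataOfK T.D T.K) pp.1 x)) *
          logNorm T.K (placeOf (pilotDataOfK T.D T.K) pp.1 x) / localDegree T.K (placeOf (pilotDataOfK T.D T.K) pp.1 x))
      (_htq : ∀ (pp : Nat.Primes) (x : (thetaIndex (pilotDataOfK T.D T.K)).Fibre (.inr pp)),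
        haveI : Fact (pp : ℕ).Prime := ⟨pp.2⟩
        Real.log ‖tq pp x‖ = -((pilotDataOfK T.D T.K).qPilot (placeOf (pilotDataOfK T.D T.K) pp.1 x)) *
          logNorm T.K (placeOf (pilotDataOfK T.D T.K) pp.1 x) / localDegree T.K (placeOf (pilotDataOfK T.D T.K) pp.1 x)),
      ∃ (ρ : (∀ v : (thetaIndex (pilotDataOfK T.D T.K)).V, v ∈ (thetaIndex (pilotDataOfK T.D T.K)).Vbad →
              Set ((logShellsDH (pilotDataOfK T.D T.K) logv).StarPacket v)) →
            ∀ (j : (thetaIndex (pilotDataOfK T.D T.K)).Label) (vQ : (thetaIndex (pilotDataOfK T.D T.K)).VQ),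
              Set ((logShellsDH (pilotDataOfK T.D T.K) logv).Packet j vQ))
          (qK : ∀ v : (thetaIndex (pilotDataOfK T.D T.K)).V, v ∈ (thetaIndex (pilotDataOfK T.D T.K)).Vbad →
            Set ((logShellsDH (pilotDataOfK T.D T.K) logv).StarPacket v)),
          QPinned ({ toSituation := situationPrVol (pilotDataOfK T.D T.K) hlog M archPk archSub Ψ act Mmod region, col := col } :
              LatticeSituation (thetaIndex (pilotDataOfK T.D T.K)))
            (settingPrVolSharp (pilotDataOfK T.D T.K) hlog M archPk archSub Ψ act Mmod region n lat sig split qData tq t htq0 htq1) ρ qK ∧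
          PilotKummerCompatHull ({ toSituation := situationPrVol (pilotDataOfK T.D T.K) hlog M archPk archSub Ψ act Mmod region, col := col } :
              LatticeSituation (thetaIndex (pilotDataOfK T.D T.K)))
            (settingPrVolSharp (pilotDataOfK T.D T.K) hlog M archPk archSub Ψ act Mmod region n lat sig split qData tq t htq0 htq1) ρ qK) := by
  refine ⟨fun hL0 hne => WRow.not_exists_qPinned_and_hull_of_chosen T ((WRow.n3_whole hmem hl h7 T).1 hL0 hne), fun hLp => ?_⟩
  simp only [List.mem_cons, Prod.mk.injEq, List.not_mem_nil, or_false] at hmem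
  rcases hmem with ⟨rfl, rfl, rfl, rfl⟩ | ⟨rfl, rfl, rfl, rfl⟩ | ⟨rfl, rfl, rfl, rfl⟩ | ⟨rfl, rfl, rfl, rfl⟩ | ⟨rfl, rfl, rfl, rfl⟩ | ⟨rfl, rfl, rfl, rfl⟩ | ⟨rfl, rfl, rfl, rfl⟩ | ⟨rfl, rfl, rfl, rfl⟩ | ⟨rfl, rfl, rfl, rfl⟩ | ⟨rfl, rfl, rfl, rfl⟩ | ⟨rfl, rfl, rfl, rfl⟩ | ⟨rfl, rfl, rfl, rfl⟩ | ⟨rfl, rfl, rfl, rfl⟩ | ⟨rfl, rfl, rfl, rfl⟩ | ⟨rfl, rfl, rfl, rfl⟩ | ⟨rfl, rfl, rfl, rfl⟩ | ⟨rfl, rfl, rfl, rfl⟩ | ⟨rfl, rfl, rfl, rfl⟩ | ⟨rfl, rfl, rfl, rfl⟩ | ⟨rfl, rfl, rfl, rfl⟩ | ⟨rfl, rfl, rfl, rfl⟩ | ⟨rfl, rfl, rfl, rfl⟩ | ⟨rfl, rfl, rfl, rfl⟩ | ⟨rfl, rfl, rfl, rfl⟩ | ⟨rfl, rfl, rfl,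 rfl⟩ | ⟨rfl, rfl, rfl, rfl⟩ | ⟨rfl, rfl, rfl, rfl⟩ | ⟨rfl, rfl, rfl, rfl⟩ | ⟨rfl, rfl, rfl, rfl⟩ | ⟨rfl, rfl, rfl, rfl⟩ | ⟨rfl, rfl, rfl, rfl⟩ | ⟨rfl, rfl, rfl, rfl⟩ | ⟨rfl, rfl, rfl, rfl⟩ | ⟨rfl, rfl, rfl, rfl⟩ | ⟨rfl, rfl, rfl, rfl⟩ | ⟨rfl, rfl, rfl, rfl⟩ | ⟨rfl, rfl, rfl, rfl⟩
  · exact WRow.exists_qPinned_and_hull_frey301327048_all l hl hLp T  -- λ = 1 / 301327048, L⁺ = 11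
  · exact WRow.exists_qPinned_and_hull_triple_139344708952637771_inhband hl hLp T  -- λ = 11 * 103 ^ 8 / 5 ^ 11 * 7 ^ 10 * 79 * 389 ^ 2, L⁺ = 7429539
  · exact WRow.exists_qPinned_and_hull_triple_611596453_inhband hl hLp T  -- λ = 13 * 19 ^ 6 / 3 ^ 13 * 11 ^ 2 * 31, L⁺ = 1181
  · exact WRow.exists_qPinned_and_hull_triple_188728275341281_inhband hl hLp T  -- λ = 13 ^ 10 * 37 ^ 2 / 2 ^ 26 * 5 ^ 12 * 1873, L⁺ = 114097
  · exact WRow.exists_qPinned_and_hull_triple_2546698687_inhband hl hLp T  -- λ = 13 ^ 5 * 19 ^ 3 / 3 ^ 38 * 397, L⁺ = 8609239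
  · exact WRow.exists_qPinned_and_hull_triple_83521_inhband hl hLp T  -- λ = 17 ^ 4 / 3 ^ 9 * 5 ^ 6 * 13 ^ 5 * 23 * 191, L⁺ = 20075
  · exact WRow.exists_qPinned_and_hull_triple_24833_inhband hl hLp T  -- λ = 19 * 1307 / 2 ^ 8 * 3 ^ 22 * 5 ^ 4, L⁺ = 59287
  · exact WRow.exists_qPinned_and_hull_triple_557832031250_inhband hl hLp T  -- λ = 2 * 5 ^ 10 * 13 ^ 4 / 11 ^ 8 * 109 ^ 2 * 3677 ^ 3, L⁺ = 3709
  · exact WRow.exists_qPinned_and_hull_reyssat_all l hl hLp T  -- λ = 2 / 6436343, L⁺ = 167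
  · exact WRow.exists_qPinned_and_hull_frey283_all l hl hLp T  -- λ = 283 / 8251953408, L⁺ = 13
  · exact WRow.exists_qPinned_and_hull_triple_3463816043689_inhband hl hLp T  -- λ = 29 ^ 4 * 2213 ^ 2 / 2 ^ 9 * 5 ^ 16 * 11 ^ 9 * 79, L⁺ = 28319567
  · exact WRow.exists_qPinned_and_hull_triple_504423766399592448_inhband hl hLp T  -- λ = 2 ^ 11 * 3 ^ 4 * 101 ^ 4 * 29221 / 5 ^ 15 * 17 * 53093 ^ 2, L⁺ = 1211942741
  · exact WRow.exists_qPinned_and_hull_triple_99794037551104_inhband hl hLp T  -- λ = 2 ^ 12 * 13 ^ 3 * 223 ^ 3 / 5 ^ 15 * 179 ^ 4 * 2141, L⁺ = 6137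
  · exact WRow.exists_qPinned_and_hull_triple_25916008300544_inhband hl hLp T  -- λ = 2 ^ 19 * 367 ^ 3 / 13 ^ 2 * 251 ^ 6, L⁺ = 3148401
  · exact WRow.exists_qPinned_and_hull_triple_44_inhband hl hLp T  -- λ = 2 ^ 2 * 11 / 5 ^ 9 * 139 ^ 6, L⁺ = 532349
  · exact WRow.exists_qPinned_and_hull_triple_1411792877634228_inhband hl hLp T  -- λ = 2 ^ 2 * 3 ^ 4 * 163 ^ 3 * 1006151 / 11 ^ 9 * 29 ^ 4 * 101 ^ 3, L⁺ = 804537083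
  · exact WRow.exists_qPinned_and_hull_frey1618481116086272_uniform hLp T  -- λ = 2 ^ 46 * 23 / 19 ^ 11 * 59 * 7207, L⁺ = 148540
  · exact WRow.exists_qPinned_and_hull_frey31117999167337103924704_uniform hLp T  -- λ = 2 ^ 5 * 67 ^ 8 * 107 * 22381 / 3 ^ 22 * 7 ^ 14 * 43 * 83, L⁺ = 1322706
  · exact WRow.exists_qPinned_and_hull_triple_12130039035706446400_inhband hl hLp T  -- λ = 2 ^ 6 * 5 ^ 2 * 7 ^ 13 * 13 ^ 2 * 463 / 11 ^ 12 * 389 ^ 2 * 6841, L⁺ = 1234870267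
  · exact WRow.exists_qPinned_and_hull_triple_10023806115968_inhband hl hLp T  -- λ = 2 ^ 7 * 23 ^ 8 / 3 ^ 22 * 13 * 47 ^ 2 * 263, L⁺ = 46897
  · exact WRow.exists_qPinned_and_hull_triple_14321927484375_inhband hl hLp T  -- λ = 3 * 5 ^ 6 * 7 ^ 8 * 53 / 2 * 11 ^ 6 * 193 ^ 4 * 20551, L⁺ = 307414715
  · exact WRow.exists_qPinned_and_hull_triple_3005846374259060721_inhband hl hLp T  -- λ = 3 ^ 22 * 9787 ^ 2 / 2 ^ 37 * 89 ^ 3 * 167 ^ 2 * 1823, L⁺ = 6600945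
  · exact WRow.exists_qPinned_and_hull_triple_377933067_inhband hl hLp T  -- λ = 3 ^ 3 * 241 ^ 3 / 2 ^ 15 * 17 ^ 2 * 331 * 1061 ^ 4, L⁺ = 70879
  · exact WRow.exists_qPinned_and_hull_triple_12304697054518521_inhband hl hLp T  -- λ = 3 ^ 4 * 23 ^ 6 * 1013 ^ 2 / 7 * 131 ^ 7 * 1373, L⁺ = 147587
  · exact WRow.exists_qPinned_and_hull_triple_2753424041748046875_inhband hl hLp T  -- λ = 3 ^ 5 * 5 ^ 15 * 13 ^ 5 / 2 ^ 11 * 73 ^ 7 * 83 ^ 2 * 197, L⁺ = 26015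
  · exact WRow.exists_qPinned_and_hull_triple_466157462602565_inhband hl hLp T  -- λ = 5 * 67 ^ 3 * 127 ^ 2 * 19219 / 2 * 3 ^ 15 * 7 ^ 2 * 31 ^ 10, L⁺ = 1957753435
  · exact WRow.exists_qPinned_and_hull_triple_289111328125_inhband_diff hl hLp T  -- λ = 5 ^ 11 * 31 * 191 / 3 ^ 30 * 13 ^ 4 * 277, L⁺ = 956545
  · exact WRow.exists_qPinned_and_hull_triple_115966796875_inhband hl hLp T  -- λ = 5 ^ 14 * 19 / 11 ^ 7 * 37 ^ 2 * 353, L⁺ = 11739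
  · exact WRow.exists_qPinned_and_hull_triple_110330191652531040475_inhband hl hLp T  -- λ = 5 ^ 2 * 23 ^ 10 * 106531 / 2 ^ 4 * 3 ^ 19 * 17 ^ 8 * 29, L⁺ = 2051897
  · exact WRow.exists_qPinned_and_hull_triple_2707160810382798173125_inhband hl hLp T  -- λ = 5 ^ 4 * 19 ^ 13 * 103 / 3 ^ 19 * 11 ^ 4 * 463 ^ 5, L⁺ = 5645475
  · exact WRow.exists_qPinned_and_hull_triple_8168354035667660710457_inhband hl hLp T  -- λ = 71 ^ 8 * 233 ^ 3 / 3 ^ 38 * 13 ^ 4 * 5233, L⁺ = 8609239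
  · exact WRow.exists_qPinned_and_hull_frey73_all l hl hLp T  -- λ = 73 / 5973865915867209, L⁺ = 29
  · exact WRow.exists_qPinned_and_hull_frey37569208117_all l hl hLp T  -- λ = 7 ^ 11 * 19 / 2 ^ 28 * 3 ^ 12 * 11 ^ 3 * 67, L⁺ = 1663
  · exact WRow.exists_qPinned_and_hull_triple_2477678547239_inhband hl hLp T  -- λ = 7 ^ 2 * 41 ^ 2 * 311 ^ 3 / 2 * 3 ^ 3 * 5 ^ 23 * 953, L⁺ = 12991229
  · exact WRow.exists_qPinned_and_hull_triple_160412424963707_inhband hl hLp T  -- λ = 7 ^ 3 * 29 ^ 5 * 151 ^ 2 / 3 ^ 27 * 13 ^ 4, L⁺ = 159395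
  · exact WRow.exists_qPinned_and_hull_frey343_all l hl hLp T  -- λ = 343 / 59392, L⁺ = 5
  · exact WRow.exists_qPinned_and_hull_triple_1025227_inhband hl hLp T  -- λ = 7 ^ 5 * 61 / 3 ^ 13 * 5 ^ 8 * 11 ^ 3 * 53 * 73 ^ 2 * 89 ^ 2 * 103, L⁺ = 1687

end Summit.ABC.IUTFork.Conditional

end
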